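import Literature.Geometry.ComplexAnalytic.RelativeExponentialChart
import Literature.Geometry.Manifold.InverseFunctionTheoremRCLike
import HarnessLib

/-!
# E8-5 «ÉTALE BY THE HOLOMORPHIC INVERSE FUNCTION THEOREM»: the étale clause of a relative exponential chart from the bijectivity
# of the differential of `ex` ([FritzscheGrauert2002] Ch. I §7 Thm. 7.6; [BirkenhakeLange2004] §1.1, Ch. 8)

Layer `Literature/Geometry/ComplexAnalytic`, namespace `Literature.Geometry.ComplexAnalytic`.  THEOREMS ONLY (no definition, no named
fact, no instance, no notation, no `sorry`).  Cell `hodgecm-mathlib` (D-0151), FLOOR 0, P6 «MOD» (crux hLiu418 = stmt-HodgeConjecture-24832,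
`--supports`), line L7 ∕ would-be L8 «REL-EXP» (organ **E8-5** of LA7-p01 (g0)'s CENSUS-P1 `F0/P6/L7/LA7-p01/g0/CENSUS-P1-relativeExponential.v1…md`:
the `exists_localInverse` field of ★ `IsRelExpChartOn` for the relative exponential `ex` of an abelian scheme, from `D ex` bijective — which the
flow construction (E8-2) and the invariant frame (E8-1) give pointwise).  Over ★ `isLocalDiffeomorphAt_of_mfderiv_rclike` at `𝕜 = ℂ`.
HC_CM is proved only modulo the printed citations (2 remaining named inputs hLiu418 24832, h413 24833) until rung 0 closes; generic, count 0.

* **`exists_localInverse_of_bijective_mfderiv`** — for `ex : B × E → M` of class `C^n` (`n ≠ 0`, complex models) on the open `U × E` with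
  bijective complex differential at every point of `U × E` (all model spaces finite-dimensional): every point of `U × E` has an
  `OpenPartialHomeomorph` onto an open of `M` agreeing with `ex` on its source `⊆ U × E`, WITH HOLOMORPHIC INVERSE — token for token the
  `exists_localInverse` field of ★ `IsRelExpChartOn`.

## References
* [FritzscheGrauert2002] K. Fritzsche, H. Grauert, *From Holomorphic Functions to Complex Manifolds* (2002), Ch. I §7 Thm. 7.6.
* [BirkenhakeLange2004] C. Birkenhake, H. Lange, *Complex Abelian Varieties*, 2nd ed. (2004), §1.1 and Ch. 8.
* [LeeSmoothManifolds2013] J. M. Lee, *Introduction to Smooth Manifolds*, 2nd ed. (2013), Thm. 4.5.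
-/

set_option autoImplicit false

noncomputable section

open Set Function
open scoped Manifold ContDiff Topology

namespace Literature.Geometry.ComplexAnalytic

variable {EB : Type*} [NormedAddCommGroup EB] [NormedSpace ℂ EB] [FiniteDimensional ℂ EB]
  {B : Type*} [TopologicalSpace B] [ChartedSpace EB B]
  {E : Type*} [NormedAddCommGroup E] [NormedSpace ℂ E] [FiniteDimensional ℂ E]
  {EM : Type*} [NormedAddCommGroup EM] [NormedSpace ℂ EM]
  {M : Type*} [TopologicalSpace M] [ChartedSpace EM M]

/-- **E8-5: THE ÉTALE CLAUSE FROM A BIJECTIVE DIFFERENTIAL** (holomorphic inverse function theorem on the product manifold `B × E`).  Let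
`ex : B × E → M` be `C^n`, `n ≠ 0`, for the complex models `𝓘(ℂ, EB) × 𝓘(ℂ, E)` and `𝓘(ℂ, EM)` on the open set `U × E`, with
`mfderiv … ex q` bijective at every `q ∈ U × E`.  Then every `q ∈ U × E` lies in the source of an `OpenPartialHomeomorph (B × E) M` which
agrees with `ex` on its source, has source inside `U × E`, and whose INVERSE IS HOLOMORPHIC on its target — the last field of ★
`IsRelExpChartOn EB EM p U Φ ex`, verbatim.  (For the relative exponential of an abelian scheme `D ex` is bijective everywhere: in the fibre
direction by translation invariance of the frame, in the base direction because `ex (·, z)` covers the base.)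
[cite: FritzscheGrauert2002, Ch. I §7 Thm. 7.6] [cite: LeeSmoothManifolds2013, Thm. 4.5] -/
theorem exists_localInverse_of_bijective_mfderiv {n : WithTop ℕ∞} (hn : n ≠ 0)
    [IsManifold 𝓘(ℂ, EB) n B] [IsManifold 𝓘(ℂ, EM) n M]
    {U : Set B} (hU : IsOpen U) {ex : B × E → M}
    (hex : ContMDiffOn (𝓘(ℂ, EB).prod 𝓘(ℂ, E)) 𝓘(ℂ, EM) n ex (U ×ˢ (univ : Set E)))
    (hbij : ∀ q ∈ U ×ˢ (univ : Set E), Bijective (mfderiv (𝓘(ℂ, EB).prod 𝓘(ℂ, E)) 𝓘(ℂ, EM) ex q)) :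
    ∀ q ∈ U ×ˢ (univ : Set E), ∃ e : OpenPartialHomeomorph (B × E) M,
      q ∈ e.source ∧ e.source ⊆ U ×ˢ univ ∧ (∀ y ∈ e.source, e y = ex y) ∧
        MDifferentiableOn 𝓘(ℂ, EM) (𝓘(ℂ, EB).prod 𝓘(ℂ, E)) e.symm e.target := by
  intro q hq
  have hUE : IsOpen (U ×ˢ (univ : Set E)) := hU.prod isOpen_univ
  -- the differential as a continuous linear equivalence (finite dimension)
  let L : (EB × E) →L[ℂ] EM := mfderiv (𝓘(ℂ, EB).prod 𝓘(ℂ, E)) 𝓘(ℂ, EM) ex q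
  have hLb : Bijective L := hbij q hq
  let f' : (EB × E) ≃L[ℂ] EM :=
    LinearEquiv.toContinuousLinearEquiv (LinearEquiv.ofBijective (L : (EB × E) →ₗ[ℂ] EM) hLb)
  have hf' : mfderiv (𝓘(ℂ, EB).prod 𝓘(ℂ, E)) 𝓘(ℂ, EM) ex q = (f' : (EB × E) →L[ℂ] EM) := by
    ext v
    rfl
  -- the holomorphic inverse function theorem on the product manifold
  obtain ⟨Φ, hqΦ, hexΦ⟩ := Literature.Geometry.Manifold.isLocalDiffeomorphAt_of_mfderiv_rclike (𝕜 := ℂ)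
    (I := (𝓘(ℂ, EB).prod 𝓘(ℂ, E))) (J := 𝓘(ℂ, EM)) hn hUE hq hex f' hf'
  -- restrict to `U × E` and read off the clause
  refine ⟨Φ.toOpenPartialHomeomorph.restrOpen (U ×ˢ univ) hUE, ⟨hqΦ, hq⟩, fun y hy => hy.2, fun y hy => (hexΦ hy.1).symm, ?_⟩
  intro y hy
  have hy' : y ∈ Φ.target := hy.1
  exact ((Φ.contMDiffOn_invFun y hy').mdifferentiableWithinAt hn).mono fun z hz => hz.1

end Literature.Geometry.ComplexAnalytic

end
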